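import Summits.Ventures.Crystal3D.Theorems.StickyWulffConstantTextureLiminfLineCountGlue
import Summits.Ventures.Crystal3D.Theorems.StickyWulffConstantGenericWallFloorBarlowOrientedGlueOneSided
import Summits.Ventures.Crystal3D.Theorems.StickyWulffConstantGenericWallFloorBarlowOneSidedTop
import HarnessLib

/-!
# The covered wall cell from a ONE-SIDED line count: the T-side companion of K1a
# (lane T, crux `TextureLiminfV5`, stmt-Ventures-23912; cf-p1 DECISION (xciii)(5) / ruling 03:15:18Z (a) «canonical-slot companion FIRST»)

HONEST FRAMING. Venture `Summits/Ventures/Crystal3D` (cell `crystal3d-full`), route `route-Ventures-StickyWulffConstant`, helper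
`--supports` the law-v5 crux `TextureLiminfV5` (stmt-Ventures-23912).  Bookkeeping only, standard axioms; nothing about any wall law is
claimed beyond the stated implications; rung F-C1 not moved.

WHAT.  Lane G's K1a (19480-p2, `barlow_hlines_oriented_oneSided` p691515 / `barlow_hlines_oriented_oneSided_top` p691813) delivers, for ONE
up-presented Δ-steep plate whose canonical walker family is frames-apart from the facing plate (clause (i) resp. (ii) of `FramesApart` alone),
a zig selector and, in every cell, a finite set `T` of that plate's h-lines through the height window with
`#T + 18·m·ρ ≤ Σ_PAY (12 − deg) + (318 + 192 R₀)(1 + h)ρ`.  The two-family glue `bilayerWallAt_of_lineCount` (…LineCountGlue) cannot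
consume this (it wants BOTH plates' windows covered).  This file is the one-family version:
* `two_charge_wallSlice_le_of_inner` — the margin bookkeeping, once: a bound `N` for the charge of the shrunken slice `wallSlice (ρ − M)`
  gives `N + 18·M·ρ` for `wallSlice ρ` (annulus volume `≤ 2πρM`, table `≤ √2`, `4√2π ≤ 18`);
* `two_charge_le_lines_oneSided_inner` / `…_inner_top` — `charge_le_flux` with the OTHER plate's flux set to `0` and
  `plate_lines_ge_flux_sel` for the dominating plate: a table with `c i j ≤ plateFlux τ₀ L₁ σ₁ e₃ i / 2` (resp.
  `≤ plateFlux τ₀ L₂ σ₂ (−e₃) j / 2`) has slice charge `2Q ≤ #T`;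
* `cell_charge_le_lines_oneSided_margin_sel` / `…_top` — the cell form with rim and margin:
  `2Q(wallSlice ρ) ≤ #T + 80(R₀+9)(1+h)ρ + 18mρ`;
* `bilayerWallAt_of_lineCount_oneSided` / `…_top` — K1a's deliverable shape ⇒ `BilayerWallAt ((C_w + 80(R₀+9) + 3456 + 1152(R₀+1))/2) R₀ …`
  via `bilayerWallAt_of_payerBound`;
* `bilayerWallAt_of_K1a` / `bilayerWallAt_of_K1a_top` — composed with K1a BY NAME (canonical slot, up-presented plate, `R₀ ≥ 6`,
  `C_w = 318 + 192 R₀`).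
The general-slot version (`IsZigSelectorAt v`, cf-p1 03:15:18Z (a)) comes after 19480-p2's `…_oneSided_at v`.
WHAT THIS IS NOT: no proof of any wall law or of any registered stub; F-C1 not moved.
-/

noncomputable section

namespace Summit.Ventures.Crystal3D.Theorems

open MeasureTheory Set
open scoped ENNReal InnerProductSpace
open Literature.MathematicalPhysics.StatisticalMechanics (IsHaggSeq triangularVec₁ triangularVec₂ fccStacking)
open Summit.Ventures.Crystal3D.Cruxes.TextureLiminf.TexShadow (E3 e₃ cyl stacking laySlab bilayerRise PlateLaunchable plateFlux
  BilayerWallAt upSlot₁ upSlot₂ upSlot₃)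

/-! ## Margin bookkeeping, once -/

/-- **Margin bookkeeping.** If the charge of the shrunken slice `wallSlice (ρ - M)` is at most `N` whenever `M < ρ`, then the charge of
`wallSlice ρ` is at most `N + 18·M·ρ` (the annulus has volume `≤ 2πρM`, the table is `≤ √2`, and `4√2π ≤ 18`). -/
theorem two_charge_wallSlice_le_of_inner (L₁ L₂ : E3 ≃ₗᵢ[ℝ] E3) (s₁ s₂ : E3) (c : ℤ → ℤ → ℝ) (hc0 : ∀ i j, 0 ≤ c i j)
    (hcB : ∀ i j, c i j ≤ Real.sqrt 2) {ρ M N : ℝ} (hρ : 0 ≤ ρ) (hM : 0 ≤ M) (hN : 0 ≤ N)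
    (hinner : M < ρ →
      2 * ∑' ij : ℤ × ℤ, c ij.1 ij.2 * (volume (wallSlice (ρ - M) ∩ laySlab L₁ s₁ ij.1 ∩ laySlab L₂ s₂ ij.2)).toReal ≤ N) :
    2 * ∑' ij : ℤ × ℤ, c ij.1 ij.2 * (volume (wallSlice ρ ∩ laySlab L₁ s₁ ij.1 ∩ laySlab L₂ s₂ ij.2)).toReal ≤ N + 18 * M * ρ := by
  have hs2 : 0 ≤ Real.sqrt 2 := Real.sqrt_nonneg 2
  have h418 := four_sqrt_two_pi_le
  have hπ0 := Real.pi_pos.le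
  have hSfin : ∀ r, 0 ≤ r → volume (wallSlice r) ≠ ⊤ := fun r hr => by rw [volume_wallSlice r hr]; exact ENNReal.ofReal_ne_top
  by_cases hsmall : ρ ≤ M
  · -- the whole slice is margin
    have h1 := two_charge_le_const L₁ L₂ s₁ s₂ c (Real.sqrt 2) hc0 hcB (wallSlice ρ) (measurableSet_wallSlice ρ) (hSfin ρ hρ)
    rw [volume_wallSlice ρ hρ, ENNReal.toReal_ofReal (by positivity)] at h1
    have h2 : Real.pi * ρ ^ 2 ≤ Real.pi * (ρ * M) := mul_le_mul_of_nonneg_left (by nlinarith) hπ0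
    have h3 : 2 * Real.sqrt 2 * (Real.pi * (ρ * M)) ≤ 18 * M * ρ := by
      have : 2 * Real.sqrt 2 * (Real.pi * (ρ * M)) = (2 * Real.sqrt 2 * Real.pi) * (M * ρ) := by ring
      rw [this]
      have h4 : 2 * Real.sqrt 2 * Real.pi ≤ 9 := by linarith
      nlinarith [mul_nonneg hM hρ]
    nlinarith [mul_le_mul_of_nonneg_left h2 (by positivity : 0 ≤ 2 * Real.sqrt 2)]
  push Not at hsmall
  have hin := hinner hsmall
  set ρ' : ℝ := ρ - M with hρ'
  have hρ'0 : 0 ≤ ρ' := by rw [hρ']; linarith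
  have hρ'ρ : ρ' ≤ ρ := by rw [hρ']; linarith
  -- split the charge into inner slice and margin annulus
  set S : Set E3 := wallSlice ρ with hS
  set S' : Set E3 := wallSlice ρ' with hS'
  set ann : Set E3 := S \ S' with hann
  have hS'S : S' ⊆ S := wallSlice_mono hρ'ρ hρ'0
  have hSm : MeasurableSet S := measurableSet_wallSlice ρ
  have hS'm : MeasurableSet S' := measurableSet_wallSlice ρ'
  have hannm : MeasurableSet ann := hSm.diff hS'm
  have hannfin : volume ann ≠ ⊤ := ne_top_of_le_ne_top (hSfin ρ hρ) (measure_mono Set.sdiff_subset)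
  set f : Set E3 → ℤ × ℤ → ℝ := fun X ij => c ij.1 ij.2 * (volume (X ∩ laySlab L₁ s₁ ij.1 ∩ laySlab L₂ s₂ ij.2)).toReal with hf
  have hsplit : ∀ ij, f S ij = f S' ij + f ann ij := by
    intro ij
    simp only [hf]
    have hset : S ∩ laySlab L₁ s₁ ij.1 ∩ laySlab L₂ s₂ ij.2 =
        (S' ∩ laySlab L₁ s₁ ij.1 ∩ laySlab L₂ s₂ ij.2) ∪ (ann ∩ laySlab L₁ s₁ ij.1 ∩ laySlab L₂ s₂ ij.2) := by
      rw [← Set.union_inter_distrib_right, ← Set.union_inter_distrib_right, hann, Set.union_sdiff_cancel hS'S]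
    have hdisj : Disjoint (S' ∩ laySlab L₁ s₁ ij.1 ∩ laySlab L₂ s₂ ij.2) (ann ∩ laySlab L₁ s₁ ij.1 ∩ laySlab L₂ s₂ ij.2) :=
      (Set.disjoint_sdiff_right).mono (Set.inter_subset_left.trans Set.inter_subset_left)
        (Set.inter_subset_left.trans Set.inter_subset_left)
    rw [hset, measure_union hdisj ((hannm.inter (measurableSet_laySlab L₁ s₁ _)).inter (measurableSet_laySlab L₂ s₂ _)),
      ENNReal.toReal_add (ne_top_of_le_ne_top (hSfin ρ' hρ'0) (measure_mono (Set.inter_subset_left.trans Set.inter_subset_left)))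
        (ne_top_of_le_ne_top hannfin (measure_mono (Set.inter_subset_left.trans Set.inter_subset_left))), mul_add]
  have hsumS' := summable_charge L₁ L₂ s₁ s₂ c (Real.sqrt 2) hc0 hcB S' hS'm (hSfin ρ' hρ'0)
  have hsumA := summable_charge L₁ L₂ s₁ s₂ c (Real.sqrt 2) hc0 hcB ann hannm hannfin
  have hQ : ∑' ij, f S ij = ∑' ij, f S' ij + ∑' ij, f ann ij := by
    rw [← hsumS'.tsum_add hsumA]; exact tsum_congr hsplit
  -- the margin annulus at `√2` per unit volume
  have hA := two_charge_le_const L₁ L₂ s₁ s₂ c (Real.sqrt 2) hc0 hcB ann hannm hannfin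
  have hvolann : (volume ann).toReal = Real.pi * ρ ^ 2 - Real.pi * ρ' ^ 2 := by
    have hu : volume S = volume S' + volume ann := by
      rw [← measure_union (Set.disjoint_sdiff_right) hannm, Set.union_sdiff_cancel hS'S]
    rw [hS, hS', volume_wallSlice ρ hρ, volume_wallSlice ρ' hρ'0] at hu
    have h1 : volume ann = ENNReal.ofReal (Real.pi * ρ ^ 2) - ENNReal.ofReal (Real.pi * ρ' ^ 2) :=
      (ENNReal.sub_eq_of_eq_add_rev ENNReal.ofReal_ne_top hu).symm
    rw [h1, ← ENNReal.ofReal_sub _ (by positivity), ENNReal.toReal_ofReal]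
    nlinarith [mul_le_mul_of_nonneg_left (pow_le_pow_left₀ hρ'0 hρ'ρ 2) hπ0]
  have hannle : (volume ann).toReal ≤ 2 * Real.pi * ρ * M := by
    rw [hvolann, hρ']; nlinarith [mul_nonneg hπ0 (sq_nonneg M)]
  have h1 : 2 * ∑' ij, f S' ij ≤ N := by
    simp only [hf] at hin ⊢; exact hin
  have h2 : 2 * ∑' ij, f ann ij ≤ 2 * Real.sqrt 2 * (2 * Real.pi * ρ * M) := by
    simp only [hf] at hA ⊢
    exact hA.trans (mul_le_mul_of_nonneg_left hannle (by positivity))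
  have hconst : 2 * Real.sqrt 2 * (2 * Real.pi * ρ * M) ≤ 18 * M * ρ := by
    have : 2 * Real.sqrt 2 * (2 * Real.pi * ρ * M) = (4 * Real.sqrt 2 * Real.pi) * (M * ρ) := by ring
    rw [this]; nlinarith [mul_nonneg hM hρ]
  have hmain : 2 * ∑' ij, f S ij ≤ N + 18 * M * ρ := by
    rw [hQ, mul_add]; linarith
  simp only [hf] at hmain
  exact hmain

/-! ## The inner one-family flux counts -/

/-- **Inner one-family flux count, bottom plate.**  On the slice of radius `ρ'`, a table dominated by HALF the bottom plate's flux
(`c i j ≤ plateFlux τ₀ L₁ σ₁ e₃ i / 2`) has charge `2Q ≤ #T₁`, `T₁` any finite set containing the plate-1 h-lines (of the zig selector)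
through the window `[-R₀-4, -R₀-3] × {lateral ≤ ρ' + 4R₀ + 36}` (`charge_le_flux` with `κ₂ ≡ 0`, then `plate_lines_ge_flux_sel`). -/
theorem two_charge_le_lines_oneSided_inner {σ₁ : ℤ → ℤ} (hσ₁ : IsHaggSeq σ₁)
    (L₁ L₂ : E3 ≃ₗᵢ[ℝ] E3) (s₁ s₂ : E3) (τ₀ R₀ ρ' : ℝ) (hR₀ : 1 ≤ R₀) (hρ' : 0 ≤ ρ')
    (c : ℤ → ℤ → ℝ) (hc0 : ∀ i j, 0 ≤ c i j) (hdom : ∀ i j, c i j ≤ plateFlux τ₀ L₁ σ₁ e₃ i / 2)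
    {step₁ : ℤ → E3} (hsel₁ : IsZigSelector L₁ σ₁ e₃ step₁) (T₁ : Finset (Fin 2 → ℤ))
    (hT₁ : ∀ t : Fin 2 → ℤ, (∃ k : ℤ,
        -R₀ - 4 ≤ (L₁ (zigVertexS step₁ k + ((t 0 : ℝ) • triangularVec₁ 1 + (t 1 : ℝ) • triangularVec₂ 1)) + s₁) 2 ∧
        (L₁ (zigVertexS step₁ k + ((t 0 : ℝ) • triangularVec₁ 1 + (t 1 : ℝ) • triangularVec₂ 1)) + s₁) 2 ≤ -R₀ - 3 ∧
        Real.sqrt ((L₁ (zigVertexS step₁ k + ((t 0 : ℝ) • triangularVec₁ 1 + (t 1 : ℝ) • triangularVec₂ 1)) + s₁) 0 ^ 2 +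
          (L₁ (zigVertexS step₁ k + ((t 0 : ℝ) • triangularVec₁ 1 + (t 1 : ℝ) • triangularVec₂ 1)) + s₁) 1 ^ 2) ≤
          ρ' + 4 * R₀ + 36) → t ∈ T₁) :
    2 * ∑' ij : ℤ × ℤ, c ij.1 ij.2 * (volume (wallSlice ρ' ∩ laySlab L₁ s₁ ij.1 ∩ laySlab L₂ s₂ ij.2)).toReal ≤ (T₁.card : ℝ) := by
  have he₃ : ‖(e₃ : E3)‖ = 1 := by rw [e₃, PiLp.norm_single, norm_one]
  have hi₃ : ∀ p : E3, ⟪p, e₃⟫_ℝ = p 2 := fun p => by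
    rw [e₃, EuclideanSpace.inner_single_right]; simp
  have hs2 : 0 ≤ Real.sqrt 2 := Real.sqrt_nonneg 2
  have hSfin : volume (wallSlice ρ') ≠ ⊤ := by rw [volume_wallSlice ρ' hρ']; exact ENNReal.ofReal_ne_top
  have hdomκ : ∀ i j, c i j ≤ (plateFlux τ₀ L₁ σ₁ e₃ i + (fun _ : ℤ => (0 : ℝ)) j) / 2 := fun i j => by
    simpa only [add_zero] using hdom i j
  have hflux := charge_le_flux L₁ L₂ s₁ s₂ (plateFlux τ₀ L₁ σ₁ e₃) (fun _ => 0) c (Real.sqrt 2)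
    (plateFlux_nonneg τ₀ L₁ σ₁ he₃) (plateFlux_le_sqrt_two τ₀ L₁ σ₁ he₃) (fun _ => le_rfl) (fun _ => hs2) hc0 hdomκ
    (wallSlice ρ') (measurableSet_wallSlice ρ') hSfin
  simp only [zero_mul, tsum_zero, add_zero] at hflux
  have hsub : wallSlice ρ' ⊆ {p : E3 | (0 : ℝ) ≤ ⟪p, e₃⟫_ℝ ∧ ⟪p, e₃⟫_ℝ ≤ 0 + 1 ∧ Real.sqrt (p 0 ^ 2 + p 1 ^ 2) ≤ ρ'} := by
    rintro p ⟨h1, h2, h3⟩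
    refine ⟨by rw [hi₃]; exact h1, by rw [hi₃]; linarith, ?_⟩
    rw [← Real.sqrt_sq hρ']; exact Real.sqrt_le_sqrt h3
  have hP₁ := plate_lines_ge_flux_sel hσ₁ L₁ s₁ e₃ he₃ hsel₁ τ₀ ρ' 0 (-R₀ - 4) (by linarith) (wallSlice ρ')
    (measurableSet_wallSlice ρ') hSfin hsub T₁
    (fun t ⟨k, hk1, hk2, hk3⟩ => hT₁ t ⟨k, by rw [hi₃] at hk1; linarith, by rw [hi₃] at hk2; linarith,
      hk3.trans (by linarith)⟩)
  exact hflux.trans hP₁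

/-- **Inner one-family flux count, top plate** (toward `-e₃`): the same with `c i j ≤ plateFlux τ₀ L₂ σ₂ (-e₃) j / 2` and the plate-2
window `[h+R₀+3, h+R₀+4] × {lateral ≤ ρ' + 4h + 4R₀ + 36}`. -/
theorem two_charge_le_lines_oneSided_inner_top {σ₂ : ℤ → ℤ} (hσ₂ : IsHaggSeq σ₂)
    (L₁ L₂ : E3 ≃ₗᵢ[ℝ] E3) (s₁ s₂ : E3) (τ₀ R₀ h ρ' : ℝ) (hR₀ : 1 ≤ R₀) (hh : 0 ≤ h) (hρ' : 0 ≤ ρ')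
    (c : ℤ → ℤ → ℝ) (hc0 : ∀ i j, 0 ≤ c i j) (hdom : ∀ i j, c i j ≤ plateFlux τ₀ L₂ σ₂ (-e₃) j / 2)
    {step₂ : ℤ → E3} (hsel₂ : IsZigSelector L₂ σ₂ (-e₃) step₂) (T₂ : Finset (Fin 2 → ℤ))
    (hT₂ : ∀ t : Fin 2 → ℤ, (∃ k : ℤ,
        h + R₀ + 3 ≤ (L₂ (zigVertexS step₂ k + ((t 0 : ℝ) • triangularVec₁ 1 + (t 1 : ℝ) • triangularVec₂ 1)) + s₂) 2 ∧
        (L₂ (zigVertexS step₂ k + ((t 0 : ℝ) • triangularVec₁ 1 + (t 1 : ℝ) • triangularVec₂ 1)) + s₂) 2 ≤ h + R₀ + 4 ∧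
        Real.sqrt ((L₂ (zigVertexS step₂ k + ((t 0 : ℝ) • triangularVec₁ 1 + (t 1 : ℝ) • triangularVec₂ 1)) + s₂) 0 ^ 2 +
          (L₂ (zigVertexS step₂ k + ((t 0 : ℝ) • triangularVec₁ 1 + (t 1 : ℝ) • triangularVec₂ 1)) + s₂) 1 ^ 2) ≤
          ρ' + 4 * h + 4 * R₀ + 36) → t ∈ T₂) :
    2 * ∑' ij : ℤ × ℤ, c ij.1 ij.2 * (volume (wallSlice ρ' ∩ laySlab L₁ s₁ ij.1 ∩ laySlab L₂ s₂ ij.2)).toReal ≤ (T₂.card : ℝ) := by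
  have he₃ : ‖(e₃ : E3)‖ = 1 := by rw [e₃, PiLp.norm_single, norm_one]
  have hne₃ : ‖(-e₃ : E3)‖ = 1 := by rw [norm_neg, he₃]
  have hi₃ : ∀ p : E3, ⟪p, e₃⟫_ℝ = p 2 := fun p => by
    rw [e₃, EuclideanSpace.inner_single_right]; simp
  have hs2 : 0 ≤ Real.sqrt 2 := Real.sqrt_nonneg 2
  have hSfin : volume (wallSlice ρ') ≠ ⊤ := by rw [volume_wallSlice ρ' hρ']; exact ENNReal.ofReal_ne_top
  have hdomκ : ∀ i j, c i j ≤ ((fun _ : ℤ => (0 : ℝ)) i + plateFlux τ₀ L₂ σ₂ (-e₃) j) / 2 := fun i j => by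
    simpa only [zero_add] using hdom i j
  have hflux := charge_le_flux L₁ L₂ s₁ s₂ (fun _ => 0) (plateFlux τ₀ L₂ σ₂ (-e₃)) c (Real.sqrt 2)
    (fun _ => le_rfl) (fun _ => hs2) (plateFlux_nonneg τ₀ L₂ σ₂ hne₃) (plateFlux_le_sqrt_two τ₀ L₂ σ₂ hne₃) hc0 hdomκ
    (wallSlice ρ') (measurableSet_wallSlice ρ') hSfin
  simp only [zero_mul, tsum_zero, zero_add] at hflux
  have hsub : wallSlice ρ' ⊆ {p : E3 | (-1 : ℝ) ≤ ⟪p, -e₃⟫_ℝ ∧ ⟪p, -e₃⟫_ℝ ≤ -1 + 1 ∧ Real.sqrt (p 0 ^ 2 + p 1 ^ 2) ≤ ρ'} := by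
    rintro p ⟨h1, h2, h3⟩
    refine ⟨by rw [inner_neg_right, hi₃]; linarith, by rw [inner_neg_right, hi₃]; linarith, ?_⟩
    rw [← Real.sqrt_sq hρ']; exact Real.sqrt_le_sqrt h3
  have hP₂ := plate_lines_ge_flux_sel hσ₂ L₂ s₂ (-e₃) hne₃ hsel₂ τ₀ ρ' (-1) (-h - R₀ - 4) (by linarith) (wallSlice ρ')
    (measurableSet_wallSlice ρ') hSfin hsub T₂
    (fun t ⟨k, hk1, hk2, hk3⟩ => hT₂ t ⟨k, by rw [inner_neg_right, hi₃] at hk2; linarith,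
      by rw [inner_neg_right, hi₃] at hk1; linarith, hk3.trans (by linarith)⟩)
  exact hflux.trans hP₂

/-! ## The cell form: rim + margin -/

/-- **One-sided cell bound, bottom plate, with margin.**  For a table dominated by half the bottom plate's flux and a finite set `T₁`
containing that plate's selector h-lines through the window `[-R₀-4, -R₀-3] × {lateral ≤ ρ − m}`:
`2Q(wallSlice ρ) ≤ #T₁ + 80(R₀+9)(1+h)ρ + 18mρ` (rim `d = 4h + 4R₀ + 36` and margin `m` priced at `√2` per unit volume). -/
theorem cell_charge_le_lines_oneSided_margin_sel {σ₁ : ℤ → ℤ} (hσ₁ : IsHaggSeq σ₁)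
    (L₁ L₂ : E3 ≃ₗᵢ[ℝ] E3) (s₁ s₂ : E3) (τ₀ R₀ h ρ : ℝ) (hR₀ : 1 ≤ R₀) (hh : 0 ≤ h) (hρ : 0 ≤ ρ)
    (c : ℤ → ℤ → ℝ) (hc0 : ∀ i j, 0 ≤ c i j) (hdom : ∀ i j, c i j ≤ plateFlux τ₀ L₁ σ₁ e₃ i / 2)
    {step₁ : ℤ → E3} (hsel₁ : IsZigSelector L₁ σ₁ e₃ step₁) (m : ℝ) (hm : 0 ≤ m) (T₁ : Finset (Fin 2 → ℤ))
    (hT₁ : ∀ t : Fin 2 → ℤ, (∃ k : ℤ,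
        -R₀ - 4 ≤ (L₁ (zigVertexS step₁ k + ((t 0 : ℝ) • triangularVec₁ 1 + (t 1 : ℝ) • triangularVec₂ 1)) + s₁) 2 ∧
        (L₁ (zigVertexS step₁ k + ((t 0 : ℝ) • triangularVec₁ 1 + (t 1 : ℝ) • triangularVec₂ 1)) + s₁) 2 ≤ -R₀ - 3 ∧
        Real.sqrt ((L₁ (zigVertexS step₁ k + ((t 0 : ℝ) • triangularVec₁ 1 + (t 1 : ℝ) • triangularVec₂ 1)) + s₁) 0 ^ 2 +
          (L₁ (zigVertexS step₁ k + ((t 0 : ℝ) • triangularVec₁ 1 + (t 1 : ℝ) • triangularVec₂ 1)) + s₁) 1 ^ 2) ≤ ρ - m) →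
        t ∈ T₁) :
    2 * ∑' ij : ℤ × ℤ, c ij.1 ij.2 * (volume (wallSlice ρ ∩ laySlab L₁ s₁ ij.1 ∩ laySlab L₂ s₂ ij.2)).toReal ≤
      (T₁.card : ℝ) + 80 * (R₀ + 9) * (1 + h) * ρ + 18 * m * ρ := by
  have he₃ : ‖(e₃ : E3)‖ = 1 := by rw [e₃, PiLp.norm_single, norm_one]
  have hs2 : 0 ≤ Real.sqrt 2 := Real.sqrt_nonneg 2
  have hcB : ∀ i j, c i j ≤ Real.sqrt 2 := fun i j =>
    (hdom i j).trans (by linarith [plateFlux_le_sqrt_two τ₀ L₁ σ₁ he₃ i])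
  set d : ℝ := 4 * h + 4 * R₀ + 36 with hd
  have hd0 : 0 ≤ d := by rw [hd]; linarith
  have hRh : 0 ≤ (R₀ + 9) * (1 + h) := mul_nonneg (by linarith) (by linarith)
  have hdle : 18 * d * ρ ≤ 80 * (R₀ + 9) * (1 + h) * ρ := by
    have h1 : 18 * d ≤ 80 * (R₀ + 9) * (1 + h) := by rw [hd]; nlinarith
    nlinarith
  have hmain := two_charge_wallSlice_le_of_inner L₁ L₂ s₁ s₂ c hc0 hcB (ρ := ρ) (M := m + d) (N := (T₁.card : ℝ)) hρ
    (by linarith) (Nat.cast_nonneg _) (fun _ =>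
      two_charge_le_lines_oneSided_inner hσ₁ L₁ L₂ s₁ s₂ τ₀ R₀ (ρ - (m + d)) hR₀ (by linarith) c hc0 hdom hsel₁ T₁
        (fun t ⟨k, hk1, hk2, hk3⟩ => hT₁ t ⟨k, hk1, hk2, hk3.trans (by rw [hd]; linarith)⟩))
  linarith

/-- **One-sided cell bound, top plate, with margin** (toward `-e₃`; the plate-2 window `[h+R₀+3, h+R₀+4] × {lateral ≤ ρ − m}`). -/
theorem cell_charge_le_lines_oneSided_margin_sel_top {σ₂ : ℤ → ℤ} (hσ₂ : IsHaggSeq σ₂)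
    (L₁ L₂ : E3 ≃ₗᵢ[ℝ] E3) (s₁ s₂ : E3) (τ₀ R₀ h ρ : ℝ) (hR₀ : 1 ≤ R₀) (hh : 0 ≤ h) (hρ : 0 ≤ ρ)
    (c : ℤ → ℤ → ℝ) (hc0 : ∀ i j, 0 ≤ c i j) (hdom : ∀ i j, c i j ≤ plateFlux τ₀ L₂ σ₂ (-e₃) j / 2)
    {step₂ : ℤ → E3} (hsel₂ : IsZigSelector L₂ σ₂ (-e₃) step₂) (m : ℝ) (hm : 0 ≤ m) (T₂ : Finset (Fin 2 → ℤ))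
    (hT₂ : ∀ t : Fin 2 → ℤ, (∃ k : ℤ,
        h + R₀ + 3 ≤ (L₂ (zigVertexS step₂ k + ((t 0 : ℝ) • triangularVec₁ 1 + (t 1 : ℝ) • triangularVec₂ 1)) + s₂) 2 ∧
        (L₂ (zigVertexS step₂ k + ((t 0 : ℝ) • triangularVec₁ 1 + (t 1 : ℝ) • triangularVec₂ 1)) + s₂) 2 ≤ h + R₀ + 4 ∧
        Real.sqrt ((L₂ (zigVertexS step₂ k + ((t 0 : ℝ) • triangularVec₁ 1 + (t 1 : ℝ) • triangularVec₂ 1)) + s₂) 0 ^ 2 +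
          (L₂ (zigVertexS step₂ k + ((t 0 : ℝ) • triangularVec₁ 1 + (t 1 : ℝ) • triangularVec₂ 1)) + s₂) 1 ^ 2) ≤ ρ - m) →
        t ∈ T₂) :
    2 * ∑' ij : ℤ × ℤ, c ij.1 ij.2 * (volume (wallSlice ρ ∩ laySlab L₁ s₁ ij.1 ∩ laySlab L₂ s₂ ij.2)).toReal ≤
      (T₂.card : ℝ) + 80 * (R₀ + 9) * (1 + h) * ρ + 18 * m * ρ := by
  have he₃ : ‖(e₃ : E3)‖ = 1 := by rw [e₃, PiLp.norm_single, norm_one]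
  have hne₃ : ‖(-e₃ : E3)‖ = 1 := by rw [norm_neg, he₃]
  have hs2 : 0 ≤ Real.sqrt 2 := Real.sqrt_nonneg 2
  have hcB : ∀ i j, c i j ≤ Real.sqrt 2 := fun i j =>
    (hdom i j).trans (by linarith [plateFlux_le_sqrt_two τ₀ L₂ σ₂ hne₃ j])
  set d : ℝ := 4 * h + 4 * R₀ + 36 with hd
  have hd0 : 0 ≤ d := by rw [hd]; linarith
  have hRh : 0 ≤ (R₀ + 9) * (1 + h) := mul_nonneg (by linarith) (by linarith)
  have hdle : 18 * d * ρ ≤ 80 * (R₀ + 9) * (1 + h) * ρ := by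
    have h1 : 18 * d ≤ 80 * (R₀ + 9) * (1 + h) := by rw [hd]; nlinarith
    nlinarith
  have hmain := two_charge_wallSlice_le_of_inner L₁ L₂ s₁ s₂ c hc0 hcB (ρ := ρ) (M := m + d) (N := (T₂.card : ℝ)) hρ
    (by linarith) (Nat.cast_nonneg _) (fun _ =>
      two_charge_le_lines_oneSided_inner_top hσ₂ L₁ L₂ s₁ s₂ τ₀ R₀ h (ρ - (m + d)) hR₀ hh (by linarith) c hc0 hdom hsel₂ T₂
        (fun t ⟨k, hk1, hk2, hk3⟩ => hT₂ t ⟨k, hk1, hk2, hk3.trans (by rw [hd]; linarith)⟩))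
  linarith

/-! ## K1a's deliverable shape ⇒ the covered cell -/

/-- **One-sided line count ⇒ the covered cell inequality (bottom plate).**  K1a's deliverable shape for plate 1 — a zig selector and, per
cell, `m ≥ 0` and a finite `T₁ ⊇ {plate-1 window lines at lateral ≤ ρ − m}` with `#T₁ + 18mρ ≤ Σ_PAY(12 − deg) + C_w(1+h)ρ` — gives
`BilayerWallAt ((C_w + 80(R₀+9) + 3456 + 1152(R₀+1))/2) R₀` for every table dominated by half plate 1's flux. -/
theorem bilayerWallAt_of_lineCount_oneSided {σ₁ σ₂ : ℤ → ℤ} (hσ₁ : IsHaggSeq σ₁) (hσ₂ : IsHaggSeq σ₂)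
    (L₁ L₂ : E3 ≃ₗᵢ[ℝ] E3) (s₁ s₂ : E3) (τ₀ R₀ C_w : ℝ) (hR₀ : 3 ≤ R₀)
    (c : ℤ → ℤ → ℝ) (hc0 : ∀ i j, 0 ≤ c i j) (hdom : ∀ i j, c i j ≤ plateFlux τ₀ L₁ σ₁ e₃ i / 2)
    {step₁ : ℤ → E3} (hsel₁ : IsZigSelector L₁ σ₁ e₃ step₁)
    (hF : ∀ h : ℝ, 0 ≤ h → ∀ ρ : ℝ, R₀ ≤ ρ → ∀ X P₁ P₂ : Finset E3,
      (∀ p ∈ X, ∀ q ∈ X, p ≠ q → 1 ≤ dist p q) → P₁ ⊆ X → P₂ ⊆ X \ P₁ → (∀ p ∈ X, p ∈ cyl R₀ h ρ) →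
      (∀ p, p ∈ P₁ ↔ (p ∈ stacking L₁ s₁ σ₁ ∧ -(2 * R₀) ≤ p 2 ∧ p 2 ≤ -R₀ ∧ p 0 ^ 2 + p 1 ^ 2 ≤ ρ ^ 2)) →
      (∀ p, p ∈ P₂ ↔ (p ∈ stacking L₂ s₂ σ₂ ∧ h + R₀ ≤ p 2 ∧ p 2 ≤ h + 2 * R₀ ∧ p 0 ^ 2 + p 1 ^ 2 ≤ ρ ^ 2)) →
      ∃ (m : ℝ) (T₁ : Finset (Fin 2 → ℤ)), 0 ≤ m ∧
        (∀ t : Fin 2 → ℤ, (∃ k : ℤ,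
          -R₀ - 4 ≤ (L₁ (zigVertexS step₁ k + ((t 0 : ℝ) • triangularVec₁ 1 + (t 1 : ℝ) • triangularVec₂ 1)) + s₁) 2 ∧
          (L₁ (zigVertexS step₁ k + ((t 0 : ℝ) • triangularVec₁ 1 + (t 1 : ℝ) • triangularVec₂ 1)) + s₁) 2 ≤ -R₀ - 3 ∧
          Real.sqrt ((L₁ (zigVertexS step₁ k + ((t 0 : ℝ) • triangularVec₁ 1 + (t 1 : ℝ) • triangularVec₂ 1)) + s₁) 0 ^ 2 +
            (L₁ (zigVertexS step₁ k + ((t 0 : ℝ) • triangularVec₁ 1 + (t 1 : ℝ) • triangularVec₂ 1)) + s₁) 1 ^ 2) ≤ ρ - m) →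
          t ∈ T₁) ∧
        (T₁.card : ℝ) + 18 * m * ρ ≤
          (∑ y ∈ X.filter (fun y => (X.filter fun q => dist y q = 1).card ≠ 12 ∧ -R₀ - 2 ≤ y 2 ∧ y 2 ≤ h + R₀ + 2),
            ((12 : ℝ) - ((X.filter fun q => dist y q = 1).card : ℝ))) + C_w * (1 + h) * ρ) :
    BilayerWallAt ((C_w + 80 * (R₀ + 9) + 3456 + 1152 * (R₀ + 1)) / 2) R₀ σ₁ σ₂ L₁ L₂ s₁ s₂ c := by
  classical
  have hR₀1 : 1 ≤ R₀ := by linarith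
  refine bilayerWallAt_of_payerBound hσ₁ hσ₂ L₁ L₂ s₁ s₂ R₀ (C_w + 80 * (R₀ + 9)) hR₀ c ?_
  intro h hh ρ hρ X P₁ P₂ hX hP₁X hP₂X hcell hP₁ hP₂
  obtain ⟨m, T₁, hm, hT₁, hcount⟩ := hF h hh ρ hρ X P₁ P₂ hX hP₁X hP₂X hcell hP₁ hP₂
  have hρ0 : 0 ≤ ρ := by linarith
  have hcellbound := cell_charge_le_lines_oneSided_margin_sel hσ₁ L₁ L₂ s₁ s₂ τ₀ R₀ h ρ hR₀1 hh hρ0 c hc0 hdom hsel₁ m hm T₁ hT₁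
  have hset : ({q : E3 | 0 ≤ q 2 ∧ q 2 ≤ 1 ∧ q 0 ^ 2 + q 1 ^ 2 ≤ ρ ^ 2} : Set E3) = wallSlice ρ := rfl
  rw [hset]
  have hsplit : (C_w + 80 * (R₀ + 9)) * (1 + h) * ρ = C_w * (1 + h) * ρ + 80 * (R₀ + 9) * (1 + h) * ρ := by ring
  rw [hsplit]
  linarith

/-- **One-sided line count ⇒ the covered cell inequality (top plate)**, the twin for plate 2 (toward `-e₃`). -/
theorem bilayerWallAt_of_lineCount_oneSided_top {σ₁ σ₂ : ℤ → ℤ} (hσ₁ : IsHaggSeq σ₁) (hσ₂ : IsHaggSeq σ₂)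
    (L₁ L₂ : E3 ≃ₗᵢ[ℝ] E3) (s₁ s₂ : E3) (τ₀ R₀ C_w : ℝ) (hR₀ : 3 ≤ R₀)
    (c : ℤ → ℤ → ℝ) (hc0 : ∀ i j, 0 ≤ c i j) (hdom : ∀ i j, c i j ≤ plateFlux τ₀ L₂ σ₂ (-e₃) j / 2)
    {step₂ : ℤ → E3} (hsel₂ : IsZigSelector L₂ σ₂ (-e₃) step₂)
    (hF : ∀ h : ℝ, 0 ≤ h → ∀ ρ : ℝ, R₀ ≤ ρ → ∀ X P₁ P₂ : Finset E3,
      (∀ p ∈ X, ∀ q ∈ X, p ≠ q → 1 ≤ dist p q) → P₁ ⊆ X → P₂ ⊆ X \ P₁ → (∀ p ∈ X, p ∈ cyl R₀ h ρ) →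
      (∀ p, p ∈ P₁ ↔ (p ∈ stacking L₁ s₁ σ₁ ∧ -(2 * R₀) ≤ p 2 ∧ p 2 ≤ -R₀ ∧ p 0 ^ 2 + p 1 ^ 2 ≤ ρ ^ 2)) →
      (∀ p, p ∈ P₂ ↔ (p ∈ stacking L₂ s₂ σ₂ ∧ h + R₀ ≤ p 2 ∧ p 2 ≤ h + 2 * R₀ ∧ p 0 ^ 2 + p 1 ^ 2 ≤ ρ ^ 2)) →
      ∃ (m : ℝ) (T₂ : Finset (Fin 2 → ℤ)), 0 ≤ m ∧
        (∀ t : Fin 2 → ℤ, (∃ k : ℤ,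
          h + R₀ + 3 ≤ (L₂ (zigVertexS step₂ k + ((t 0 : ℝ) • triangularVec₁ 1 + (t 1 : ℝ) • triangularVec₂ 1)) + s₂) 2 ∧
          (L₂ (zigVertexS step₂ k + ((t 0 : ℝ) • triangularVec₁ 1 + (t 1 : ℝ) • triangularVec₂ 1)) + s₂) 2 ≤ h + R₀ + 4 ∧
          Real.sqrt ((L₂ (zigVertexS step₂ k + ((t 0 : ℝ) • triangularVec₁ 1 + (t 1 : ℝ) • triangularVec₂ 1)) + s₂) 0 ^ 2 +
            (L₂ (zigVertexS step₂ k + ((t 0 : ℝ) • triangularVec₁ 1 + (t 1 : ℝ) • triangularVec₂ 1)) + s₂) 1 ^ 2) ≤ ρ - m) →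
          t ∈ T₂) ∧
        (T₂.card : ℝ) + 18 * m * ρ ≤
          (∑ y ∈ X.filter (fun y => (X.filter fun q => dist y q = 1).card ≠ 12 ∧ -R₀ - 2 ≤ y 2 ∧ y 2 ≤ h + R₀ + 2),
            ((12 : ℝ) - ((X.filter fun q => dist y q = 1).card : ℝ))) + C_w * (1 + h) * ρ) :
    BilayerWallAt ((C_w + 80 * (R₀ + 9) + 3456 + 1152 * (R₀ + 1)) / 2) R₀ σ₁ σ₂ L₁ L₂ s₁ s₂ c := by
  classical
  have hR₀1 : 1 ≤ R₀ := by linarith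
  refine bilayerWallAt_of_payerBound hσ₁ hσ₂ L₁ L₂ s₁ s₂ R₀ (C_w + 80 * (R₀ + 9)) hR₀ c ?_
  intro h hh ρ hρ X P₁ P₂ hX hP₁X hP₂X hcell hP₁ hP₂
  obtain ⟨m, T₂, hm, hT₂, hcount⟩ := hF h hh ρ hρ X P₁ P₂ hX hP₁X hP₂X hcell hP₁ hP₂
  have hρ0 : 0 ≤ ρ := by linarith
  have hcellbound := cell_charge_le_lines_oneSided_margin_sel_top hσ₂ L₁ L₂ s₁ s₂ τ₀ R₀ h ρ hR₀1 hh hρ0 c hc0 hdom hsel₂ m hm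
    T₂ hT₂
  have hset : ({q : E3 | 0 ≤ q 2 ∧ q 2 ≤ 1 ∧ q 0 ^ 2 + q 1 ^ 2 ≤ ρ ^ 2} : Set E3) = wallSlice ρ := rfl
  rw [hset]
  have hsplit : (C_w + 80 * (R₀ + 9)) * (1 + h) * ρ = C_w * (1 + h) * ρ + 80 * (R₀ + 9) * (1 + h) * ρ := by ring
  rw [hsplit]
  linarith

/-! ## Composed with K1a by name (canonical slot) -/

/-- **K1a ⇒ the covered cell, bottom plate, canonical slot.**  Under lane G's E1 and star facts, for an UP-presented Δ-steep plate 1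
(`0 ≤ (L₁⁻¹ e₃)₂`, canonical family slot `best3 … upSlot₁ upSlot₂ upSlot₃` rising `≥ √2/2`) whose canonical walker chain frames are
all distinct from plate 2's frame and its twin (clause (i) of `FramesApart`), and `R₀ ≥ 6`: every nonnegative table dominated by HALF
plate 1's flux (`c i j ≤ plateFlux τ₀ L₁ σ₁ e₃ i / 2`, any `τ₀`) satisfies
`BilayerWallAt ((318 + 192R₀ + 80(R₀+9) + 3456 + 1152(R₀+1))/2) R₀ σ₁ σ₂ L₁ L₂ s₁ s₂ c`
(`barlow_hlines_oriented_oneSided`, p691515, then `bilayerWallAt_of_lineCount_oneSided`). -/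
theorem bilayerWallAt_of_K1a {sE : E3} (hsE : sE ∈ fccSlots) (hcert : ExactOnly 0 (fccSlots.filter fun w => 0 < ⟪w, sE⟫_ℝ))
    (hDS : ∀ F₁ F₂ : E3 ≃ₗᵢ[ℝ] E3, DoubleStarCoaxialAt F₁ F₂) (hCP : CapPairCoaxial)
    {σ₁ σ₂ : ℤ → ℤ} (hσ₁ : IsHaggSeq σ₁) (hσ₂ : IsHaggSeq σ₂) (L₁ L₂ : E3 ≃ₗᵢ[ℝ] E3) (s₁ s₂ : E3)
    (hax₁ : 0 ≤ (L₁.symm e₃) 2)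
    (hsteep₁ : Real.sqrt 2 / 2 ≤ ⟪L₁ (best3 (fun w => ⟪w, L₁.symm e₃⟫_ℝ) upSlot₁ upSlot₂ upSlot₃), e₃⟫_ℝ)
    (hapart₁ : ∀ F ∈ chainFrames e₃ L₁ (best3 (fun w => ⟪w, L₁.symm e₃⟫_ℝ) upSlot₁ upSlot₂ upSlot₃),
      F '' fccStacking 1 (Real.sqrt (2 / 3)) ≠ L₂ '' fccStacking 1 (Real.sqrt (2 / 3)) ∧
      F '' fccStacking 1 (Real.sqrt (2 / 3)) ≠ (twinFrame L₂ (L₂ e₃)) '' fccStacking 1 (Real.sqrt (2 / 3)))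
    (R₀ : ℝ) (hR₀ : 6 ≤ R₀) (τ₀ : ℝ) (c : ℤ → ℤ → ℝ) (hc0 : ∀ i j, 0 ≤ c i j)
    (hdom : ∀ i j, c i j ≤ plateFlux τ₀ L₁ σ₁ e₃ i / 2) :
    BilayerWallAt ((318 + 192 * R₀ + 80 * (R₀ + 9) + 3456 + 1152 * (R₀ + 1)) / 2) R₀ σ₁ σ₂ L₁ L₂ s₁ s₂ c := by
  obtain ⟨step₁, hsel₁, hF⟩ :=
    barlow_hlines_oriented_oneSided hsE hcert hDS hCP hσ₁ hσ₂ L₁ L₂ s₁ s₂ hax₁ hsteep₁ hapart₁ R₀ hR₀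
  exact bilayerWallAt_of_lineCount_oneSided hσ₁ hσ₂ L₁ L₂ s₁ s₂ τ₀ R₀ (318 + 192 * R₀) (by linarith) c hc0 hdom hsel₁ hF

/-- **K1a ⇒ the covered cell, top plate, canonical slot** (plate 2 up-presented toward `-e₃`, clause (ii) of `FramesApart`;
`barlow_hlines_oriented_oneSided_top`, p691813, then `bilayerWallAt_of_lineCount_oneSided_top`). -/
theorem bilayerWallAt_of_K1a_top {sE : E3} (hsE : sE ∈ fccSlots) (hcert : ExactOnly 0 (fccSlots.filter fun w => 0 < ⟪w, sE⟫_ℝ))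
    (hDS : ∀ F₁ F₂ : E3 ≃ₗᵢ[ℝ] E3, DoubleStarCoaxialAt F₁ F₂) (hCP : CapPairCoaxial)
    {σ₁ σ₂ : ℤ → ℤ} (hσ₁ : IsHaggSeq σ₁) (hσ₂ : IsHaggSeq σ₂) (L₁ L₂ : E3 ≃ₗᵢ[ℝ] E3) (s₁ s₂ : E3)
    (hax₂ : 0 ≤ (L₂.symm (-e₃)) 2)
    (hsteep₂ : Real.sqrt 2 / 2 ≤ ⟪L₂ (best3 (fun w => ⟪w, L₂.symm (-e₃)⟫_ℝ) upSlot₁ upSlot₂ upSlot₃), -e₃⟫_ℝ)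
    (hapart₂ : ∀ F ∈ chainFrames (-e₃) L₂ (best3 (fun w => ⟪w, L₂.symm (-e₃)⟫_ℝ) upSlot₁ upSlot₂ upSlot₃),
      F '' fccStacking 1 (Real.sqrt (2 / 3)) ≠ L₁ '' fccStacking 1 (Real.sqrt (2 / 3)) ∧
      F '' fccStacking 1 (Real.sqrt (2 / 3)) ≠ (twinFrame L₁ (L₁ e₃)) '' fccStacking 1 (Real.sqrt (2 / 3)))
    (R₀ : ℝ) (hR₀ : 6 ≤ R₀) (τ₀ : ℝ) (c : ℤ → ℤ → ℝ) (hc0 : ∀ i j, 0 ≤ c i j)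
    (hdom : ∀ i j, c i j ≤ plateFlux τ₀ L₂ σ₂ (-e₃) j / 2) :
    BilayerWallAt ((318 + 192 * R₀ + 80 * (R₀ + 9) + 3456 + 1152 * (R₀ + 1)) / 2) R₀ σ₁ σ₂ L₁ L₂ s₁ s₂ c := by
  obtain ⟨step₂, hsel₂, hF⟩ :=
    barlow_hlines_oriented_oneSided_top hsE hcert hDS hCP hσ₁ hσ₂ L₁ L₂ s₁ s₂ hax₂ hsteep₂ hapart₂ R₀ hR₀
  exact bilayerWallAt_of_lineCount_oneSided_top hσ₁ hσ₂ L₁ L₂ s₁ s₂ τ₀ R₀ (318 + 192 * R₀) (by linarith) c hc0 hdom hsel₂ hF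

end Summit.Ventures.Crystal3D.Theorems

end
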